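import Mathlib.Analysis.InnerProductSpace.Positive
import Mathlib.LinearAlgebra.Matrix.PosDef
import Mathlib.LinearAlgebra.Matrix.Trace
import HarnessLib

/-!
# Rigorous error bounds for the optimal value in semidefinite programming (Jansson–Chaykin–Keil)

Topic `Literature/Computation/Certificates` (joins the kernel-checkable LP / PSD / SOS certificate
files of this directory). This file formalises, for EXACT (point) input data, the a-posteriori bounds
of

* C. Jansson, D. Chaykin, C. Keil, *Rigorous error bounds for the optimal value in semidefinite
  programming*, SIAM J. Numer. Anal. 46 (2007/08) 180–200 [JanssonChaykinKeil2008]; statements read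
  from the authors' TUHH preprint of the same title (C. Jansson, C. Keil, Hamburg University of
  Technology, tore.tuhh.de handle 11420/207; its Lemma 3.1, Theorem 3.2, Corollary 3.1, Theorem 4.1),

for the primal semidefinite program in block-diagonal form (their (1.1))
`p* = min Σ_j ⟨C_j, X_j⟩  s.t.  Σ_j ⟨A_ij, X_j⟩ = b_i (i = 1..m),  X_j ⪰ 0`, `⟨C, X⟩ = trace (Cᵀ X)`,
with Lagrangian dual `d* = max bᵀy s.t. Σ_i y_i A_ij ⪯ C_j` (their (1.3)).

What is proved (all blocks real symmetric, as in the source; indices are arbitrary finite types,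
block `j` has its own index type `σ j`):

* `trace_mul_nonneg_of_posSemidef` — `⟨P, X⟩ ≥ 0` for `P, X ⪰ 0` (the step of the proof of Lemma 3.1;
  quoted in §6 of the source);
* `JanssonChaykinKeil.trace_mul_ge` — **Lemma 3.1, trace form**: `D − d·1 ⪰ 0` (i.e. `d ≤ λ_min(D)`)
  and `X ⪰ 0` give `⟨D, X⟩ ≥ d · tr X`; `JanssonChaykinKeil.lemma_3_1` — **Lemma 3.1 as printed**:
  with moreover `x̄·1 − X ⪰ 0` (i.e. `λ_max(X) ≤ x̄`), `⟨D, X⟩ ≥ s · d⁻ · x̄`, `d⁻ = min(d, 0)`,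
  `s` = the dimension;
* `JanssonChaykinKeil.theorem_3_2` — **Theorem 3.2 (point data)**: for ANY `ỹ ∈ ℝ^m`, with
  `D_j := C_j − Σ_i ỹ_i A_ij ⪰ d_j·1`, and a set `B` of blocks with a-priori bounds `λ_max(X_j) ≤ x̄_j`
  (`j ∈ B`) while `d_j ≥ 0` for the unbounded blocks `j ∉ B` (their (3.5)–(3.6)), EVERY primal
  feasible `X` satisfies `Σ_j ⟨C_j, X_j⟩ ≥ bᵀỹ + Σ_{j∈B} s_j · d_j⁻ · x̄_j` — hence so does `p*` (their
  (3.7); the `inf` over an interval family of input data is the bookkeeping of their interval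
  version and is not needed for exact data); `theorem_3_2_traceBound` — the same with TRACE bounds
  `tr X_j ≤ τ_j` in place of `s_j x̄_j` (the form used by conic certificate verifiers);
  `weakDuality_of_dualFeasible` — the case `B = ∅` (all `d_j ≥ 0`): plain weak duality `bᵀỹ ≤ ⟨C, X⟩`;
* `JanssonChaykinKeil.corollary_3_1` — the linear-programming case (blocks of size one);
* `JanssonChaykinKeil.theorem_4_1` — **Theorem 4.1 (point data)**: a primal feasible `X̂` bounds the
  optimal value from above, `p* ≤ Σ_j ⟨C_j, X̂_j⟩` (`p*` as the infimum of the objective over the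
  feasible set);
* `JanssonChaykinKeil.lmiForm_bound` — the same argument written for a program in INEQUALITY (LMI /
  "y-") form with bounded variables, equality and inequality rows and trace-bounded PSD blocks
  `M_k(y) = C_k + Σ_v y_v F_{k,v} ⪰ 0`: for multipliers `λ` (free), `κ ≥ 0`, approximately PSD
  `Z_k ⪰ d_k·1`, residuals `r_v := c_v − Σ_r λ_r row_r[v] + Σ_i κ_i row_i[v] − Σ_k ⟨Z_k, F_{k,v}⟩` and
  `β := c₀ + r_u + Σ_r λ_r rhs_r − Σ_i κ_i upper_i − Σ_k ⟨Z_k, C_k⟩` (`u` the unit variable, `y_u = 1`),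
  every feasible `y` obeys `c·y + c₀ ≥ β − Σ_{v≠u} |r_v| ρ_v − Σ_k |min(0, d_k)| τ_k`. This is
  Theorem 3.2's mechanism (Lemma 3.1 + a-priori bounds on the unknown primal object) applied to the
  inequality form; it is the bound formula implemented by the fleet's conic certificate layer
  (certsdp `RIGOR-LAYER.md` §2) and is recorded here as a COROLLARY, not as a statement of the source.

Hypothesis shapes: `d ≤ λ_min(D)` is expressed as `(D - d • 1).PosSemidef` and `λ_max(X) ≤ x̄` as
`(x̄ • 1 - X).PosSemidef` (Courant–Fischer); the former is exactly the output shape of the verified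
Cholesky enclosures of `Literature/Analysis/InnerProduct/CholeskyResidualEigenvalueBounds.lean`
(`posSemidef_sub_of_shifted_residual_dominated`, Rump 2006), so a floating-point Cholesky run
post-processed there feeds these theorems directly. Interval input data (the source's `𝐏`) are not
treated: for exact data the source's `inf`/`sup` over the family are the point values.

No definitions, no named facts; everything is proved.

## References

* C. Jansson, D. Chaykin, C. Keil, SIAM J. Numer. Anal. 46(1) (2007/08) 180–200,
  doi:10.1137/050622870. [JanssonChaykinKeil2008]
* C. Jansson, *Rigorous lower and upper bounds in linear programming*, SIAM J. Optim. 14 (2004)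
  914–935 (the LP case, Corollary 3.1). [cited through JanssonChaykinKeil2008, ref. [10]]
* S. M. Rump, *Verification of positive definiteness*, BIT 46 (2006) 433–452 (how `d ≤ λ_min(D)` is
  certified in floating point). [Rump2006]
-/

namespace Literature.Computation.Certificates

open Matrix Finset
open scoped BigOperators

/-! ### Traces of products of positive semidefinite matrices -/

section Trace

variable {n : Type*} [Fintype n] [DecidableEq n]

omit [DecidableEq n] in
/-- `trace (P * (a bᵀ)) = bᵀ P a` (plumbing). [folklore] -/
private theorem trace_mul_vecMulVec (P : Matrix n n ℝ) (a b : n → ℝ) :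
    trace (P * vecMulVec a b) = b ⬝ᵥ (P *ᵥ a) := by
  rw [Matrix.mul_vecMulVec, Matrix.trace_vecMulVec, dotProduct_comm]

omit [DecidableEq n] in
/-- The inner product of two positive semidefinite real matrices is nonnegative:
`⟨P, X⟩ = trace (P X) ≥ 0`. (Write `X = Σ_i v_i v_iᵀ`; then `trace (P X) = Σ_i v_iᵀ P v_i ≥ 0`.)
This is the step "because the inner product of two positive semidefinite matrices is nonnegative"
of the source (§6, discussion of the `gpp` problems) and the content of the proof of its Lemma 3.1.
[cite: JanssonChaykinKeil2008, Lemma 3.1 (proof) and §6] -/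
theorem trace_mul_nonneg_of_posSemidef {P X : Matrix n n ℝ} (hP : P.PosSemidef)
    (hX : X.PosSemidef) : 0 ≤ trace (P * X) := by
  obtain ⟨m, v, hv⟩ := Matrix.posSemidef_iff_eq_sum_vecMulVec.mp hX
  rw [hv, Finset.mul_sum, Matrix.trace_sum]
  refine Finset.sum_nonneg fun i _ => ?_
  rw [trace_mul_vecMulVec]
  simpa using hP.dotProduct_mulVec_nonneg (v i)

/-- `trace X ≤ s · x̄` when `x̄·1 − X ⪰ 0` (`λ_max(X) ≤ x̄`), `s` the dimension (plumbing). [folklore] -/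
private theorem trace_le_card_mul_of_posSemidef_sub {X : Matrix n n ℝ} {xub : ℝ}
    (h : (xub • (1 : Matrix n n ℝ) - X).PosSemidef) : trace X ≤ Fintype.card n * xub := by
  have h0 := h.trace_nonneg
  rw [Matrix.trace_sub, Matrix.trace_smul, Matrix.trace_one, smul_eq_mul] at h0
  linarith

end Trace

namespace JanssonChaykinKeil

/-! ### Lemma 3.1 -/

section Lemma31

variable {n : Type*} [Fintype n] [DecidableEq n]

/-- **Jansson–Chaykin–Keil, Lemma 3.1 (trace form).** If `d ≤ λ_min(D)` (stated as `D − d·1 ⪰ 0`) and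
`X ⪰ 0` then `⟨D, X⟩ ≥ d · trace X`. [cite: JanssonChaykinKeil2008, Lemma 3.1 (proof)] -/
theorem trace_mul_ge {D X : Matrix n n ℝ} {d : ℝ} (hD : (D - d • (1 : Matrix n n ℝ)).PosSemidef)
    (hX : X.PosSemidef) : d * trace X ≤ trace (D * X) := by
  have h := trace_mul_nonneg_of_posSemidef hD hX
  rw [sub_mul, Matrix.smul_mul, one_mul, Matrix.trace_sub, Matrix.trace_smul, smul_eq_mul] at h
  linarith

/-- **Jansson–Chaykin–Keil, Lemma 3.1** (as printed). Let `D, X` be symmetric `s × s` matrices with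
`d ≤ λ_min(D)`, `0 ≤ λ_min(X)` and `λ_max(X) ≤ x̄` (stated as `D − d·1 ⪰ 0`, `X ⪰ 0`, `x̄·1 − X ⪰ 0`).
Then `⟨D, X⟩ ≥ s · d⁻ · x̄` with `d⁻ = min(0, d)`. [cite: JanssonChaykinKeil2008, Lemma 3.1] -/
theorem lemma_3_1 {D X : Matrix n n ℝ} {d xub : ℝ} (hD : (D - d • (1 : Matrix n n ℝ)).PosSemidef)
    (hX : X.PosSemidef) (hXub : (xub • (1 : Matrix n n ℝ) - X).PosSemidef) :
    Fintype.card n * min d 0 * xub ≤ trace (D * X) := by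
  have h1 := trace_mul_ge hD hX
  have h2 := hX.trace_nonneg
  have h3 := trace_le_card_mul_of_posSemidef_sub hXub
  rcases le_or_gt 0 d with hd | hd
  · rw [min_eq_right hd]
    nlinarith
  · rw [min_eq_left hd.le]
    nlinarith

end Lemma31

/-! ### Theorem 3.2: the rigorous lower bound (exact data) -/

section Theorem32

variable {ι : Type*} [Fintype ι] {σ : ι → Type*} [∀ j, Fintype (σ j)]
  [∀ j, DecidableEq (σ j)] {μ : Type*} [Fintype μ]

omit [∀ j, DecidableEq (σ j)] in
/-- Splitting the primal objective along an arbitrary dual vector `ỹ`: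
`Σ_j ⟨C_j, X_j⟩ = Σ_j ⟨C_j − Σ_i ỹ_i A_ij, X_j⟩ + Σ_i ỹ_i b_i` for every `X` satisfying the equality
constraints. [cite: JanssonChaykinKeil2008, proof of Thm 3.2] -/
theorem objective_eq_defect_add (C : ∀ j, Matrix (σ j) (σ j) ℝ) (A : μ → ∀ j, Matrix (σ j) (σ j) ℝ)
    (b : μ → ℝ) (y : μ → ℝ) {X : ∀ j, Matrix (σ j) (σ j) ℝ}
    (hAX : ∀ i, ∑ j, trace (A i j * X j) = b i) :
    ∑ j, trace (C j * X j) =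
      ∑ j, trace ((C j - ∑ i, y i • A i j) * X j) + ∑ i, y i * b i := by
  have h : ∀ j, trace (C j * X j) =
      trace ((C j - ∑ i, y i • A i j) * X j) + ∑ i, y i * trace (A i j * X j) := by
    intro j
    rw [sub_mul, Matrix.trace_sub, Finset.sum_mul, Matrix.trace_sum]
    simp only [Matrix.smul_mul, Matrix.trace_smul, smul_eq_mul]
    ring
  simp only [h, Finset.sum_add_distrib]
  congr 1
  rw [Finset.sum_comm]
  refine Finset.sum_congr rfl fun i _ => ?_
  rw [← Finset.mul_sum, hAX i]

/-- **Jansson–Chaykin–Keil, Theorem 3.2** (exact input data). Primal block SDP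
`min Σ_j ⟨C_j, X_j⟩ s.t. Σ_j ⟨A_ij, X_j⟩ = b_i, X_j ⪰ 0`. Let `ỹ ∈ ℝ^m` be arbitrary (an approximate
dual solution), `D_j := C_j − Σ_i ỹ_i A_ij`, and `d_j ≤ λ_min(D_j)` (as `D_j − d_j·1 ⪰ 0`). Let `B` be the
set of blocks for which an a-priori bound `λ_max(X_j) ≤ x̄_j` on the primal feasible solutions is known
(as `x̄_j·1 − X_j ⪰ 0`), and assume `d_j ≥ 0` for the other blocks (`x̄_j = +∞`, their (3.6)). Then every
primal feasible `X` — in particular an optimal one, so `p*` itself — satisfies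
`Σ_j ⟨C_j, X_j⟩ ≥ bᵀỹ + Σ_{j ∈ B} s_j · d_j⁻ · x̄_j`. [cite: JanssonChaykinKeil2008, Thm 3.2, (3.3)–(3.7)] -/
theorem theorem_3_2 (C : ∀ j, Matrix (σ j) (σ j) ℝ) (A : μ → ∀ j, Matrix (σ j) (σ j) ℝ) (b : μ → ℝ)
    {X : ∀ j, Matrix (σ j) (σ j) ℝ} (hX : ∀ j, (X j).PosSemidef)
    (hAX : ∀ i, ∑ j, trace (A i j * X j) = b i)
    (y : μ → ℝ) (d : ι → ℝ)
    (hD : ∀ j, (C j - ∑ i, y i • A i j - d j • (1 : Matrix (σ j) (σ j) ℝ)).PosSemidef)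
    (B : Finset ι) (xub : ι → ℝ) (hub : ∀ j ∈ B, (xub j • (1 : Matrix (σ j) (σ j) ℝ) - X j).PosSemidef)
    (hd : ∀ j ∉ B, 0 ≤ d j) :
    ∑ i, b i * y i + ∑ j ∈ B, Fintype.card (σ j) * min (d j) 0 * xub j ≤ ∑ j, trace (C j * X j) := by
  rw [objective_eq_defect_add C A b y hAX]
  have hb : ∑ i, b i * y i = ∑ i, y i * b i := Finset.sum_congr rfl fun i _ => mul_comm _ _
  -- per-block bounds
  have hblock : ∀ j, d j * trace (X j) ≤ trace ((C j - ∑ i, y i • A i j) * X j) := fun j =>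
    trace_mul_ge (hD j) (hX j)
  have hB : ∑ j ∈ B, (Fintype.card (σ j) : ℝ) * min (d j) 0 * xub j ≤
      ∑ j, trace ((C j - ∑ i, y i • A i j) * X j) :=
    calc ∑ j ∈ B, (Fintype.card (σ j) : ℝ) * min (d j) 0 * xub j
        ≤ ∑ j ∈ B, trace ((C j - ∑ i, y i • A i j) * X j) := by
          refine Finset.sum_le_sum fun j hj => ?_
          exact lemma_3_1 (hD j) (hX j) (hub j hj)
      _ ≤ ∑ j, trace ((C j - ∑ i, y i • A i j) * X j) := by
          refine Finset.sum_le_sum_of_subset_of_nonneg (Finset.subset_univ B) fun j _ hj => ?_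
          have h1 := hblock j
          have h2 := (hX j).trace_nonneg
          have h3 := hd j hj
          nlinarith
  linarith

/-- Theorem 3.2 with TRACE bounds: if `tr X_j ≤ τ_j` is known for `j ∈ B` (instead of
`λ_max(X_j) ≤ x̄_j`; e.g. moment matrices of words of operator norm `≤ 1`), then
`Σ_j ⟨C_j, X_j⟩ ≥ bᵀỹ + Σ_{j∈B} d_j⁻ · τ_j`. Same proof (Lemma 3.1 in trace form).
[cite: JanssonChaykinKeil2008, Thm 3.2 (variant: `s_j x̄_j` replaced by a trace bound)] -/
theorem theorem_3_2_traceBound (C : ∀ j, Matrix (σ j) (σ j) ℝ) (A : μ → ∀ j, Matrix (σ j) (σ j) ℝ)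
    (b : μ → ℝ) {X : ∀ j, Matrix (σ j) (σ j) ℝ} (hX : ∀ j, (X j).PosSemidef)
    (hAX : ∀ i, ∑ j, trace (A i j * X j) = b i)
    (y : μ → ℝ) (d : ι → ℝ)
    (hD : ∀ j, (C j - ∑ i, y i • A i j - d j • (1 : Matrix (σ j) (σ j) ℝ)).PosSemidef)
    (B : Finset ι) (τ : ι → ℝ) (hτ : ∀ j ∈ B, trace (X j) ≤ τ j) (hd : ∀ j ∉ B, 0 ≤ d j) :
    ∑ i, b i * y i + ∑ j ∈ B, min (d j) 0 * τ j ≤ ∑ j, trace (C j * X j) := by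
  rw [objective_eq_defect_add C A b y hAX]
  have hb : ∑ i, b i * y i = ∑ i, y i * b i := Finset.sum_congr rfl fun i _ => mul_comm _ _
  have hblock : ∀ j, d j * trace (X j) ≤ trace ((C j - ∑ i, y i • A i j) * X j) := fun j =>
    trace_mul_ge (hD j) (hX j)
  have hB : ∑ j ∈ B, min (d j) 0 * τ j ≤ ∑ j, trace ((C j - ∑ i, y i • A i j) * X j) :=
    calc ∑ j ∈ B, min (d j) 0 * τ j
        ≤ ∑ j ∈ B, trace ((C j - ∑ i, y i • A i j) * X j) := by
          refine Finset.sum_le_sum fun j hj => ?_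
          have h1 := hblock j
          have h2 := (hX j).trace_nonneg
          have h3 := hτ j hj
          rcases le_or_gt 0 (d j) with hdj | hdj
          · rw [min_eq_right hdj]; nlinarith
          · rw [min_eq_left hdj.le]; nlinarith
      _ ≤ ∑ j, trace ((C j - ∑ i, y i • A i j) * X j) := by
          refine Finset.sum_le_sum_of_subset_of_nonneg (Finset.subset_univ B) fun j _ hj => ?_
          have h1 := hblock j
          have h2 := (hX j).trace_nonneg
          have h3 := hd j hj
          nlinarith
  linarith

/-- Weak duality as the special case `B = ∅` of Theorem 3.2: if `ỹ` is dual FEASIBLE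
(`C_j − Σ_i ỹ_i A_ij ⪰ 0` for all `j`) then `bᵀỹ ≤ Σ_j ⟨C_j, X_j⟩` for every primal feasible `X`, whence
`d* ≤ p*` (their (1.4)). [cite: JanssonChaykinKeil2008, (1.4) and Thm 3.2] -/
theorem weakDuality_of_dualFeasible (C : ∀ j, Matrix (σ j) (σ j) ℝ)
    (A : μ → ∀ j, Matrix (σ j) (σ j) ℝ) (b : μ → ℝ) {X : ∀ j, Matrix (σ j) (σ j) ℝ}
    (hX : ∀ j, (X j).PosSemidef) (hAX : ∀ i, ∑ j, trace (A i j * X j) = b i) (y : μ → ℝ)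
    (hD : ∀ j, (C j - ∑ i, y i • A i j).PosSemidef) :
    ∑ i, b i * y i ≤ ∑ j, trace (C j * X j) := by
  have h := theorem_3_2 C A b hX hAX y (fun _ => 0) (fun j => by simpa using hD j) ∅ (fun _ => 0)
    (by simp) (by simp)
  simpa using h

/-- **Jansson–Chaykin–Keil, Corollary 3.1** (the linear-programming case `s_j = 1`): for
`min cᵀx s.t. A x = b, x ≥ 0` with a-priori bounds `x_j ≤ x̄_j` on `j ∈ B`, any `ỹ`, `d := c − Aᵀỹ`
with `d_j ≥ 0` off `B`: every feasible `x` has `cᵀx ≥ bᵀỹ + Σ_{j∈B} d_j⁻ x̄_j`.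
[cite: JanssonChaykinKeil2008, Cor 3.1, (3.9)–(3.11)] -/
theorem corollary_3_1 {ν : Type*} [Fintype ν] [DecidableEq ν] (c : ν → ℝ) (A : μ → ν → ℝ)
    (b : μ → ℝ) {x : ν → ℝ} (hx : ∀ j, 0 ≤ x j) (hAx : ∀ i, ∑ j, A i j * x j = b i) (y : μ → ℝ)
    (B : Finset ν) (xub : ν → ℝ) (hub : ∀ j ∈ B, x j ≤ xub j)
    (hd : ∀ j ∉ B, 0 ≤ c j - ∑ i, y i * A i j) :
    ∑ i, b i * y i + ∑ j ∈ B, min (c j - ∑ i, y i * A i j) 0 * xub j ≤ ∑ j, c j * x j := by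
  -- direct proof (the `1 × 1` case of Theorem 3.2, written out for vectors)
  have hsplit : ∑ j, c j * x j = ∑ j, (c j - ∑ i, y i * A i j) * x j + ∑ i, y i * b i := by
    have hS : ∀ j, (∑ i, y i * A i j) * x j = ∑ i, y i * (A i j * x j) := by
      intro j
      rw [Finset.sum_mul]
      exact Finset.sum_congr rfl fun i _ => by ring
    have : ∀ j, c j * x j = (c j - ∑ i, y i * A i j) * x j + ∑ i, y i * (A i j * x j) := by
      intro j; rw [← hS j]; ring
    simp only [this, Finset.sum_add_distrib]
    congr 1
    rw [Finset.sum_comm]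
    refine Finset.sum_congr rfl fun i _ => ?_
    rw [← Finset.mul_sum, hAx i]
  rw [hsplit]
  have hb : ∑ i, b i * y i = ∑ i, y i * b i := Finset.sum_congr rfl fun i _ => mul_comm _ _
  have hB : ∑ j ∈ B, min (c j - ∑ i, y i * A i j) 0 * xub j ≤
      ∑ j, (c j - ∑ i, y i * A i j) * x j :=
    calc ∑ j ∈ B, min (c j - ∑ i, y i * A i j) 0 * xub j
        ≤ ∑ j ∈ B, (c j - ∑ i, y i * A i j) * x j := by
          refine Finset.sum_le_sum fun j hj => ?_
          have h1 := hx j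
          have h2 := hub j hj
          rcases le_or_gt 0 (c j - ∑ i, y i * A i j) with hdj | hdj
          · rw [min_eq_right hdj]; nlinarith
          · rw [min_eq_left hdj.le]; nlinarith
      _ ≤ ∑ j, (c j - ∑ i, y i * A i j) * x j := by
          refine Finset.sum_le_sum_of_subset_of_nonneg (Finset.subset_univ B) fun j _ hj => ?_
          exact mul_nonneg (hd j hj) (hx j)
  linarith

/-! ### Theorem 4.1: the rigorous upper bound (exact data) -/

omit [∀ j, DecidableEq (σ j)] [Fintype μ] in
/-- **Jansson–Chaykin–Keil, Theorem 4.1** (exact input data): a primal feasible point `X̂` bounds the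
optimal value from above, `p* ≤ Σ_j ⟨C_j, X̂_j⟩`, where `p*` is the infimum of the objective over the
primal feasible set (assumed bounded below, e.g. by Theorem 3.2). In the source the point `X̂` is found
inside an interval enclosure `𝐗` verified to contain a feasible point; for exact data the enclosure is
the point. [cite: JanssonChaykinKeil2008, Thm 4.1, (4.1)–(4.3)] -/
theorem theorem_4_1 (C : ∀ j, Matrix (σ j) (σ j) ℝ) (A : μ → ∀ j, Matrix (σ j) (σ j) ℝ) (b : μ → ℝ)
    {Xh : ∀ j, Matrix (σ j) (σ j) ℝ} (hXh : ∀ j, (Xh j).PosSemidef)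
    (hAXh : ∀ i, ∑ j, trace (A i j * Xh j) = b i)
    (hbdd : BddBelow {v : ℝ | ∃ X : ∀ j, Matrix (σ j) (σ j) ℝ, (∀ j, (X j).PosSemidef) ∧
      (∀ i, ∑ j, trace (A i j * X j) = b i) ∧ v = ∑ j, trace (C j * X j)}) :
    sInf {v : ℝ | ∃ X : ∀ j, Matrix (σ j) (σ j) ℝ, (∀ j, (X j).PosSemidef) ∧
      (∀ i, ∑ j, trace (A i j * X j) = b i) ∧ v = ∑ j, trace (C j * X j)} ≤
      ∑ j, trace (C j * Xh j) :=
  csInf_le hbdd ⟨Xh, hXh, hAXh, rfl⟩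

end Theorem32

/-! ### The inequality (LMI) form used by conic certificate verifiers -/

section LMIForm

variable {V : Type*} [Fintype V] [DecidableEq V] {E : Type*} [Fintype E] {I : Type*} [Fintype I]
  {K : Type*} [Fintype K] {σ : K → Type*} [∀ k, Fintype (σ k)] [∀ k, DecidableEq (σ k)]

/-- `|min(0,d)| · τ = −(min(d,0) · τ)` (plumbing). [folklore] -/
private theorem abs_min_zero_mul (d τ : ℝ) : |min 0 d| * τ = -(min d 0 * τ) := by
  rw [min_comm, abs_of_nonpos (min_le_right d 0)]
  ring

/-- **Rigorous lower bound in inequality form** (Theorem 3.2's mechanism for a program with explicit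
bounded variables). Data: objective `c·y + c₀` over `y ∈ ℝ^V` with a unit variable `y_u = 1`, a-priori
bounds `|y_v| ≤ ρ_v` (`v ≠ u`), equality rows `row_r · y = rhs_r`, inequality rows `row_i · y ≤ upper_i`,
PSD blocks `M_k(y) = C_k + Σ_v y_v F_{k,v} ⪰ 0` with trace bounds `tr M_k(y) ≤ τ_k`. Certificate:
multipliers `λ_r` (free), `κ_i ≥ 0`, matrices `Z_k` with `Z_k − d_k·1 ⪰ 0` (`d_k ≤ λ_min(Z_k)`; `d_k = 0`
for an exactly PSD `Z_k`). With the exact residuals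
`r_v = c_v − Σ_r λ_r row_r[v] + Σ_i κ_i row_i[v] − Σ_k ⟨Z_k, F_{k,v}⟩` and
`β = c₀ + r_u + Σ_r λ_r rhs_r − Σ_i κ_i upper_i − Σ_k ⟨Z_k, C_k⟩`, every feasible `y` satisfies
`c·y + c₀ ≥ β − Σ_{v ≠ u} |r_v| ρ_v − Σ_k |min(0, d_k)| τ_k`.
(Proof: `c·y = Σ_v r_v y_v + Σ_r λ_r rhs_r − Σ_i κ_i (row_i·y) + Σ_k (⟨Z_k, M_k(y)⟩ − ⟨Z_k, C_k⟩)` and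
Lemma 3.1 in trace form.) [cite: JanssonChaykinKeil2008, Lemma 3.1 and Thm 3.2 (inequality-form
corollary; the bound formula of certsdp RIGOR-LAYER §2)] -/
theorem lmiForm_bound (c : V → ℝ) (c0 : ℝ) (u : V)
    (rowE : E → V → ℝ) (rhs : E → ℝ) (rowI : I → V → ℝ) (upper : I → ℝ)
    (Cb : ∀ k, Matrix (σ k) (σ k) ℝ) (F : ∀ k, V → Matrix (σ k) (σ k) ℝ)
    (ρ : V → ℝ) (τ : K → ℝ)
    -- a feasible point
    {y : V → ℝ} (hyu : y u = 1) (hρ : ∀ v, v ≠ u → |y v| ≤ ρ v)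
    (heq : ∀ r, ∑ v, rowE r v * y v = rhs r) (hineq : ∀ i, ∑ v, rowI i v * y v ≤ upper i)
    (hpsd : ∀ k, (Cb k + ∑ v, y v • F k v).PosSemidef)
    (hτ : ∀ k, trace (Cb k + ∑ v, y v • F k v) ≤ τ k)
    -- the certificate
    (lam : E → ℝ) (κ : I → ℝ) (hκ : ∀ i, 0 ≤ κ i) (Z : ∀ k, Matrix (σ k) (σ k) ℝ) (dZ : K → ℝ)
    (hZ : ∀ k, (Z k - dZ k • (1 : Matrix (σ k) (σ k) ℝ)).PosSemidef)
    (r : V → ℝ)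
    (hr : ∀ v, r v = c v - ∑ e, lam e * rowE e v + ∑ i, κ i * rowI i v - ∑ k, trace (Z k * F k v))
    (β : ℝ)
    (hβ : β = c0 + r u + ∑ e, lam e * rhs e - ∑ i, κ i * upper i - ∑ k, trace (Z k * Cb k)) :
    β - ∑ v ∈ Finset.univ.erase u, |r v| * ρ v - ∑ k, |min 0 (dZ k)| * τ k ≤
      ∑ v, c v * y v + c0 := by
  -- Step 1: rewrite the objective through the residuals
  have hc : ∀ v, c v = r v + ∑ e, lam e * rowE e v - ∑ i, κ i * rowI i v
      + ∑ k, trace (Z k * F k v) := by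
    intro v; rw [hr v]; ring
  have h1 : ∑ v, c v * y v = ∑ v, (r v * y v + (∑ e, lam e * rowE e v) * y v
      - (∑ i, κ i * rowI i v) * y v + (∑ k, trace (Z k * F k v)) * y v) := by
    refine Finset.sum_congr rfl fun v _ => ?_
    rw [hc v]; ring
  have hE : ∑ v, (∑ e, lam e * rowE e v) * y v = ∑ e, lam e * rhs e := by
    simp_rw [Finset.sum_mul]
    rw [Finset.sum_comm]
    refine Finset.sum_congr rfl fun e _ => ?_
    rw [← heq e, Finset.mul_sum]
    exact Finset.sum_congr rfl fun v _ => by ring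
  have hI : ∑ v, (∑ i, κ i * rowI i v) * y v = ∑ i, κ i * ∑ v, rowI i v * y v := by
    simp_rw [Finset.sum_mul]
    rw [Finset.sum_comm]
    refine Finset.sum_congr rfl fun i _ => ?_
    rw [Finset.mul_sum]
    exact Finset.sum_congr rfl fun v _ => by ring
  have hK : ∑ v, (∑ k, trace (Z k * F k v)) * y v = ∑ k, trace (Z k * ∑ v, y v • F k v) := by
    simp_rw [Finset.sum_mul]
    rw [Finset.sum_comm]
    refine Finset.sum_congr rfl fun k _ => ?_
    rw [Finset.mul_sum, Matrix.trace_sum]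
    refine Finset.sum_congr rfl fun v _ => ?_
    rw [Matrix.mul_smul, Matrix.trace_smul, smul_eq_mul, mul_comm]
  have hobj : ∑ v, c v * y v = ∑ v, r v * y v + ∑ e, lam e * rhs e
      - ∑ i, κ i * ∑ v, rowI i v * y v + ∑ k, trace (Z k * ∑ v, y v • F k v) := by
    rw [h1]
    simp only [Finset.sum_add_distrib, Finset.sum_sub_distrib]
    rw [hE, hI, hK]
  -- Step 2: the three estimates
  have hres : r u - ∑ v ∈ Finset.univ.erase u, |r v| * ρ v ≤ ∑ v, r v * y v := by
    rw [← Finset.add_sum_erase _ _ (Finset.mem_univ u), hyu, mul_one]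
    have : -(∑ v ∈ Finset.univ.erase u, |r v| * ρ v) ≤ ∑ v ∈ Finset.univ.erase u, r v * y v := by
      rw [← Finset.sum_neg_distrib]
      refine Finset.sum_le_sum fun v hv => ?_
      have hvu : v ≠ u := Finset.ne_of_mem_erase hv
      have h1 := hρ v hvu
      have h2 : |r v * y v| ≤ |r v| * ρ v := by
        rw [abs_mul]; exact mul_le_mul_of_nonneg_left h1 (abs_nonneg _)
      have h3 := neg_abs_le (r v * y v)
      linarith
    linarith
  have hrows : ∑ i, κ i * ∑ v, rowI i v * y v ≤ ∑ i, κ i * upper i :=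
    Finset.sum_le_sum fun i _ => mul_le_mul_of_nonneg_left (hineq i) (hκ i)
  have hblocks : ∀ k, -(|min 0 (dZ k)| * τ k) - trace (Z k * Cb k) ≤
      trace (Z k * ∑ v, y v • F k v) := by
    intro k
    have hsplit : trace (Z k * ∑ v, y v • F k v) =
        trace (Z k * (Cb k + ∑ v, y v • F k v)) - trace (Z k * Cb k) := by
      rw [Matrix.mul_add, Matrix.trace_add]; ring
    have h1 := trace_mul_ge (hZ k) (hpsd k)
    have h2 := (hpsd k).trace_nonneg
    have h3 := hτ k
    have h4 : min (dZ k) 0 * τ k ≤ trace (Z k * (Cb k + ∑ v, y v • F k v)) := by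
      rcases le_or_gt 0 (dZ k) with hdk | hdk
      · rw [min_eq_right hdk]; nlinarith
      · rw [min_eq_left hdk.le]; nlinarith
    rw [abs_min_zero_mul, hsplit]
    linarith
  have hsumblocks : -(∑ k, |min 0 (dZ k)| * τ k) - ∑ k, trace (Z k * Cb k) ≤
      ∑ k, trace (Z k * ∑ v, y v • F k v) := by
    have h := Finset.sum_le_sum fun k (_ : k ∈ Finset.univ) => hblocks k
    simp only [Finset.sum_sub_distrib, Finset.sum_neg_distrib] at h
    exact h
  -- Step 3: assemble
  rw [hobj, hβ]
  linarith

end LMIForm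

end JanssonChaykinKeil

end Literature.Computation.Certificates
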